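/-
Copyright (c) 2026. All rights reserved.
Released under Apache 2.0 license as described in the file LICENSE.
Authors: abc-iut cell, block C / W6 prover seat abc-iut-w6-d060 (gen 2).
-/
import Literature.IUT.LogVolume.UnitLogBallVolumeCriterion
import Literature.IUT.LogVolume.UnitLogBoundaryRamificationRoots
import HarnessLib

/-!
# `log_p(𝒪_K^×)` at DEEP ramification `e ≥ p` (`p` odd): it leaves `𝔪_K`, hence NO ball is `p^k·log_p(𝒪_K^×)`

PROOF-ONLY file (no `def`, no named fact).  Setting: `K` a proper ultrametric normed `ℚ_p`-algebra (a finite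
extension of `ℚ_p`), `p` ODD, `e = absRamificationIdx p K ≥ p`, `ϖ` a uniformizer (`‖ϖ‖^e = p⁻¹`).  Classical
`p`-adic analysis (Neukirch ANT II (5.5); Koblitz IV §1–2) beyond the range of [IUTchIV] Prop. 1.2 (i) (tree:
`prop12i_holds`), with NO hypothesis on roots of unity or on the residue degree:

* `norm_one_add_pow_prime_sub_one_eq`: with `n := ⌊e/p⌋ ≥ 1` and `x := ϖ^n`, `‖(1 + x)^p − 1‖ = ‖ϖ‖^{np}` (the term
  `x^p` dominates `p·x·R`, as `np < e + n`);
* `norm_logSeries_one_add_pow_prime_eq`: `‖log_p((1 + x)^p)‖ = ‖ϖ‖^{np}` — the ball of radius `‖ϖ‖^{np}` around `1`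
  is INSIDE the domain where `log_p` is an isometry, because `np·(p − 1) > e` (this is where `p ≥ 3` enters:
  `np(p−1) = np + np(p−2) ≥ np + p > np + (e mod p) = e`);
* `one_le_norm_logSeries_one_add_pow`: hence `‖log_p(1 + ϖ^n)‖ = ‖ϖ‖^{np}/‖p‖ = ‖ϖ‖^{np − e} ≥ 1`:
  **`log_p(𝒪_K^×) ⊄ 𝔪_K`** (`not_logUnits_subset_closedBall_of_prime_le`; for `p ∣ e` compare the tree's
  `UnitLogRamificationCriterion`: `‖log_p u‖ = 1` is attained);
* `closedBall_ne_zpow_smul_logUnits_of_prime_le`: **for every `j, k ∈ ℤ`, `{‖y‖ ≤ ‖ϖ‖^j} ≠ p^k·log_p(𝒪_K^×)`** —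
  were they equal, abc-iut-w5-d039's volume constraint `m = f·(j − ke − 1)` (`UnitLogBallVolumeCriterion`, from
  [IUTchIV] Prop. 1.4 (ii): `μ(log_p(𝒪^×)) = p^{−(f+m)}`) forces `log_p(𝒪^×) = 𝔪^{1 + m/f} ⊆ 𝔪`, contradicting
  the previous point.

Consequence for the Dupuy–Hilado (Ind2) BALL-MOVER CRITERION (`Summits/ABC/IUTFork/Thm311RealIsmDHMoverCriterion`,
abc-iut-w5-d180): at EVERY place `v | p` of a number field with `p` odd and `e(v|p) ≥ p`, EVERY ball `t·𝒪_v` is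
moved (consumer: `Summits/ABC/IUTFork/Thm311RealIsmDHMoverDeep.lean`).  With the tame range `e ≤ p − 2`
(`prop12iEq_holds`: fixed iff `e ∣ ord_v t − 1`) and the boundary `e = p − 1`
(`UnitLogBoundaryRamificationTrichotomy`) this COMPLETES the classification of (Ind2)-fixed balls over odd `p`.

References: [cite: NeukirchANT1999, Ch. II Prop. (5.5)–(5.7)] [cite: Koblitz1984, Ch. IV §1–2]; `logUnits` is the
cell's typing of [IUTchIV] Prop. 1.2's `log_p(R^×)` ([claim: Mochizuki2012, status: disputed] for that locution).
-/

noncomputable section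

open Metric Set IsUltrametricDist
open scoped Pointwise NormedField

namespace Literature.IUT.LogVolume

open Literature.NumberTheory.GaloisRepresentations.Ultrametric Literature.NumberTheory.Transcendental

namespace DeepRamification

variable (p : ℕ) [hp : Fact p.Prime]
variable {K : Type*} [NontriviallyNormedField K] [instK : NormedAlgebra ℚ_[p] K] [IsUltrametricDist K]
  [ProperSpace K]
variable {ϖ : Kˣ} (hϖ : IsUniformizer ϖ)
include hϖ

/-! ## 1. Arithmetic of `n = ⌊e/p⌋` -/

omit hp hϖ in
/-- For `e ≥ p ≥ 3` and `n = ⌊e/p⌋`: `1 ≤ n`, `n·p ≤ e` and `e < n·p·(p − 1)` (as `n·p·(p−2) ≥ p > e mod p`).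
[cite: Koblitz1984, Ch. IV §1] -/
theorem div_arith (hp3 : 3 ≤ p) {e : ℕ} (he : p ≤ e) :
    1 ≤ e / p ∧ e / p * p ≤ e ∧ (e : ℝ) < (e / p : ℕ) * (p : ℝ) * ((p : ℝ) - 1) := by
  have hp0 : 0 < p := by omega
  have hn1 : 1 ≤ e / p := (Nat.one_le_div_iff hp0).mpr he
  have hnp : e / p * p ≤ e := Nat.div_mul_le_self e p
  refine ⟨hn1, hnp, ?_⟩
  have hmod : (p : ℝ) * (e / p : ℕ) + (e % p : ℕ) = e := by exact_mod_cast Nat.div_add_mod e p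
  have hs : ((e % p : ℕ) : ℝ) < p := by exact_mod_cast Nat.mod_lt e hp0
  have hn1' : (1 : ℝ) ≤ (e / p : ℕ) := by exact_mod_cast hn1
  have hp3' : (3 : ℝ) ≤ p := by exact_mod_cast hp3
  set n : ℝ := ((e / p : ℕ) : ℝ) with hn
  have h1 : (p : ℝ) ≤ n * p := by nlinarith
  have h2 : n * p * 1 ≤ n * p * ((p : ℝ) - 2) := by
    apply mul_le_mul_of_nonneg_left (by linarith) (by positivity)
  calc (e : ℝ) = p * n + (e % p : ℕ) := hmod.symm
    _ < n * p + p := by linarith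
    _ ≤ n * p + n * p * ((p : ℝ) - 2) := by linarith
    _ = n * p * ((p : ℝ) - 1) := by ring

/-! ## 2. The test unit `1 + ϖ^n` and its `p`-th power -/

/-- `‖(1 + ϖ^n)^p − 1‖ = ‖ϖ‖^{np}` for `n = ⌊e/p⌋`, `e ≥ p ≥ 3`: in `𝒪`, `(x + 1)^p = x^p + 1 + p·x·R` (binomial theorem)
with `‖p·x·R‖ ≤ ‖ϖ‖^{e+n} < ‖ϖ‖^{np} = ‖x^p‖`. [cite: Koblitz1984, Ch. IV §1] [cite: NeukirchANT1999, Ch. II Prop. (5.5)] -/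
theorem norm_one_add_pow_prime_sub_one_eq (hp3 : 3 ≤ p) (he : p ≤ absRamificationIdx p K) :
    ‖(1 + (ϖ : K) ^ (absRamificationIdx p K / p)) ^ p - 1‖ =
      ‖(ϖ : K)‖ ^ (absRamificationIdx p K / p * p) := by
  set e := absRamificationIdx p K with he_def
  set n := e / p with hn_def
  set r := ‖(ϖ : K)‖ with hr
  obtain ⟨hn1, hnp, -⟩ := div_arith p hp3 he
  have hr0 : 0 < r := norm_units_pos ϖ
  have hr1 : r < 1 := hϖ.norm_lt_one
  set x : K := (ϖ : K) ^ n with hx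
  have hxn : ‖x‖ = r ^ n := by rw [hx, norm_pow]
  have hx1 : ‖x‖ ≤ 1 := by rw [hxn]; exact pow_le_one₀ hr0.le hr1.le
  -- binomial theorem in `𝒪`
  let W : Valued.integer K := ⟨x, Valued.integer.mem_iff.mpr hx1⟩
  obtain ⟨R, hR⟩ := exists_add_pow_prime_eq hp.out W 1
  have hRn : ‖(R : K)‖ ≤ 1 := Valued.integer.norm_le_one R
  have hK : (x + 1) ^ p = x ^ p + 1 + (p : K) * x * R := by
    have h := congrArg (fun z : Valued.integer K => (z : K)) hR
    simpa [W] using h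
  have hrew : (1 + x) ^ p - 1 = x ^ p + (p : K) * x * R := by rw [add_comm, hK]; ring
  have hbig : ‖x ^ p‖ = r ^ (n * p) := by rw [norm_pow, hxn, ← pow_mul]
  have hsmall : ‖(p : K) * x * R‖ < r ^ (n * p) := by
    rw [norm_mul, norm_mul, norm_prime_eq_norm_pow p K hϖ, hxn]
    calc r ^ e * r ^ n * ‖(R : K)‖ ≤ r ^ e * r ^ n * 1 := by gcongr
      _ = r ^ (e + n) := by rw [mul_one, pow_add]
      _ < r ^ (n * p) := pow_lt_pow_right_of_lt_one₀ hr0 hr1 (by nlinarith)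
  rw [hrew, norm_add_eq_max_of_norm_ne_norm (by rw [hbig]; exact hsmall.ne'), hbig,
    max_eq_left hsmall.le]

/-- **`‖log_p((1 + ϖ^n)^p)‖ = ‖ϖ‖^{np}`** (`n = ⌊e/p⌋`, `e ≥ p ≥ 3`): at radius `ρ = ‖ϖ‖^{np}` the contraction modulus
`ρ·p^{1/(p−1)} = p^{1/(p−1) − np/e}` is `< 1` because `np(p − 1) > e`, so `log_p` preserves the distance to `1` there.
[cite: Koblitz1984, Ch. IV §2] [cite: NeukirchANT1999, Ch. II Prop. (5.5)] -/
theorem norm_logSeries_one_add_pow_prime_eq (hp3 : 3 ≤ p) (he : p ≤ absRamificationIdx p K) :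
    ‖logSeries ((1 + (ϖ : K) ^ (absRamificationIdx p K / p)) ^ p)‖ =
      ‖(ϖ : K)‖ ^ (absRamificationIdx p K / p * p) := by
  set e := absRamificationIdx p K with he_def
  set n := e / p with hn_def
  set r := ‖(ϖ : K)‖ with hr
  obtain ⟨hn1, hnp, hkey⟩ := div_arith p hp3 he
  have hp1 : (1 : ℝ) < p := by exact_mod_cast hp.out.one_lt
  have hp0 : (0 : ℝ) < p := by linarith
  have he0 : (0 : ℝ) < e := by exact_mod_cast (show 0 < e by omega)
  have hr0 : 0 < r := norm_units_pos ϖ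
  set y : K := (1 + (ϖ : K) ^ n) ^ p with hy
  have h1y : ‖1 - y‖ = r ^ (n * p) := by
    rw [← norm_neg, neg_sub, hy]; exact norm_one_add_pow_prime_sub_one_eq p hϖ hp3 he
  -- the contraction modulus at radius `r^(np)` is `< 1`
  have hrpow : r = (p : ℝ) ^ (-(1 / (e : ℝ))) := by rw [hr]; exact norm_eq_rpow_of_isUniformizer p K hϖ
  have hθ : r ^ (n * p) * (p : ℝ) ^ (1 / ((p : ℝ) - 1)) < 1 := by
    rw [hrpow, ← Real.rpow_natCast, ← Real.rpow_mul hp0.le, ← Real.rpow_add hp0]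
    refine Real.rpow_lt_one_of_one_lt_of_neg hp1 ?_
    have hp1' : (0 : ℝ) < (p : ℝ) - 1 := by linarith
    have hlt : (1 : ℝ) / ((p : ℝ) - 1) < ((n * p : ℕ) : ℝ) / (e : ℝ) := by
      rw [div_lt_div_iff₀ hp1' he0]
      push_cast
      nlinarith [hkey]
    have hre : -(1 / (e : ℝ)) * ((n * p : ℕ) : ℝ) = -(((n * p : ℕ) : ℝ) / e) := by ring
    rw [hre]
    linarith
  have hcontr := norm_logSeries_add_le p K hθ.le (le_of_eq h1y)
  have hpos : 0 < ‖1 - y‖ := by rw [h1y]; positivity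
  have hlt : ‖logSeries y + (1 - y)‖ < ‖1 - y‖ := by
    refine hcontr.trans_lt ?_
    calc r ^ (n * p) * (p : ℝ) ^ (1 / ((p : ℝ) - 1)) * ‖1 - y‖ < 1 * ‖1 - y‖ := by gcongr
      _ = ‖1 - y‖ := one_mul _
  have hsplit : logSeries y = (logSeries y + (1 - y)) + (-(1 - y)) := by ring
  rw [hsplit, norm_add_eq_max_of_norm_ne_norm (by rw [norm_neg]; exact hlt.ne), norm_neg,
    max_eq_right hlt.le, h1y]

/-- **`‖log_p(1 + ϖ^n)‖ = ‖ϖ‖^{np}/‖p‖ ≥ 1`** for `n = ⌊e/p⌋`, `e ≥ p ≥ 3` (`log_p(y^p) = p·log_p y` and `np ≤ e`):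
a unit whose logarithm lies OUTSIDE `𝔪` (indeed outside the open unit ball). [cite: NeukirchANT1999, Ch. II Prop. (5.5)] -/
theorem one_le_norm_logSeries_one_add_pow (hp3 : 3 ≤ p) (he : p ≤ absRamificationIdx p K) :
    1 ≤ ‖logSeries (1 + (ϖ : K) ^ (absRamificationIdx p K / p))‖ := by
  set e := absRamificationIdx p K with he_def
  set n := e / p with hn_def
  set r := ‖(ϖ : K)‖ with hr
  obtain ⟨hn1, hnp, -⟩ := div_arith p hp3 he
  have hr0 : 0 < r := norm_units_pos ϖ
  have hr1 : r < 1 := hϖ.norm_lt_one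
  set y₀ : K := 1 + (ϖ : K) ^ n with hy₀
  have hP : ‖1 - y₀‖ < 1 := by
    rw [hy₀, sub_add_cancel_left, norm_neg, norm_pow]
    exact pow_lt_one₀ hr0.le hr1 (by omega)
  have hpow : logSeries (y₀ ^ p) = (p : K) * logSeries y₀ := logSeries_pow p hP p
  have hnorm := norm_logSeries_one_add_pow_prime_eq p hϖ hp3 he
  rw [← hy₀, hpow, norm_mul, norm_prime_eq_norm_pow p K hϖ] at hnorm
  -- `r^e * ‖L y₀‖ = r^(np)` with `np ≤ e`
  have hre : 0 < r ^ e := pow_pos hr0 e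
  have h1 : ‖logSeries y₀‖ = r ^ (n * p) / r ^ e := by
    rw [eq_div_iff hre.ne', mul_comm]; exact hnorm
  rw [h1, le_div_iff₀ hre, one_mul]
  exact pow_le_pow_of_le_one hr0.le hr1.le hnp

/-! ## 3. `log_p(𝒪_K^×) ⊄ 𝔪_K` and no ball is `p^k·log_p(𝒪_K^×)` -/

/-- **At `e ≥ p`, `p` odd: `log_p(𝒪_K^×)` contains an element of norm `≥ 1`.**
[cite: NeukirchANT1999, Ch. II Prop. (5.5)] -/
theorem exists_mem_logUnits_one_le_norm (hp3 : 3 ≤ p) (he : p ≤ absRamificationIdx p K) :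
    ∃ z ∈ logUnits K, 1 ≤ ‖z‖ := by
  set n := absRamificationIdx p K / p with hn_def
  obtain ⟨hn1, -, -⟩ := div_arith p hp3 he
  have hr0 : 0 < ‖(ϖ : K)‖ := norm_units_pos ϖ
  have hP : IsPrincipal (1 + (ϖ : K) ^ n) := by
    rw [IsPrincipal, sub_add_cancel_left, norm_neg, norm_pow]
    exact pow_lt_one₀ hr0.le hϖ.norm_lt_one (by omega)
  refine ⟨logSeries (1 + (ϖ : K) ^ n), ?_, one_le_norm_logSeries_one_add_pow p hϖ hp3 he⟩
  rw [← unitLog_of_isPrincipal p hP]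
  exact unitLog_mem_logUnits hP.norm_eq_one

/-- **At `e ≥ p`, `p` odd: `log_p(𝒪_K^×) ⊄ 𝔪_K = {‖z‖ ≤ ‖ϖ‖}`** — in contrast with `e ≤ p − 1`, where
`log_p(𝒪_K^×) ⊆ 𝔪_K` always (`prop12iEq_holds`, `BoundaryRamification.logUnits_subset_closedBall`).
[cite: NeukirchANT1999, Ch. II Prop. (5.5)] -/
theorem not_logUnits_subset_closedBall_of_prime_le (hp3 : 3 ≤ p) (he : p ≤ absRamificationIdx p K) :
    ¬ logUnits K ⊆ closedBall (0 : K) ‖(ϖ : K)‖ := by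
  intro hsub
  obtain ⟨z, hz, h1⟩ := exists_mem_logUnits_one_le_norm p hϖ hp3 he
  have h2 := hsub hz
  rw [mem_closedBall, dist_zero_right] at h2
  exact absurd (h1.trans h2) (not_le.mpr hϖ.norm_lt_one)

/-- **At `e ≥ p`, `p` odd: NO ball `{‖y‖ ≤ ‖ϖ‖^j}` equals `p^k · log_p(𝒪_K^×)`** (`j, k ∈ ℤ` arbitrary).  Were they
equal, `log_p(𝒪_K^×)` would be the ball of radius `‖ϖ‖^{j − ke}` and abc-iut-w5-d039's volume constraint
`m = f·(j − ke − 1) ≥ 0` ([IUTchIV] Prop. 1.4 (ii)) would give `j − ke ≥ 1`, i.e. `log_p(𝒪_K^×) ⊆ 𝔪_K` — impossible.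
No hypothesis on roots of unity or residue degree. [cite: NeukirchANT1999, Ch. II Prop. (5.5)–(5.7)]
[cite: WeilBNT1967, Ch. II §2, Th. 1–2] -/
theorem closedBall_ne_zpow_smul_logUnits_of_prime_le (hp3 : 3 ≤ p) (he : p ≤ absRamificationIdx p K)
    (j k : ℤ) : closedBall (0 : K) (‖(ϖ : K)‖ ^ j) ≠ ((p : ℚ_[p]) ^ k) • logUnits K := by
  intro h
  have hr0 : 0 < ‖(ϖ : K)‖ := norm_units_pos ϖ
  have hϖ0 : ‖(ϖ : K)‖ ≠ 0 := hr0.ne'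
  -- the volume constraint
  have hm := torsionPExp_eq_of_closedBall_eq_zpow_smul_logUnits p K hϖ h
  have hf : (0 : ℤ) < residueDegree p K := by exact_mod_cast residueDegree_pos p K
  have hm0 : (0 : ℤ) ≤ torsionPExp p K := by positivity
  have hjk : 1 ≤ j - k * absRamificationIdx p K := by
    by_contra hlt
    rw [not_le] at hlt
    have : (residueDegree p K : ℤ) * (j - k * absRamificationIdx p K - 1) < 0 :=
      mul_neg_of_pos_of_neg hf (by omega)
    omega
  -- `log_p(𝒪^×) = {‖y‖ ≤ ‖ϖ‖^(j - ke)} ⊆ 𝔪`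
  have hΛ : logUnits K = closedBall (0 : K) (‖(ϖ : K)‖ ^ (j - k * absRamificationIdx p K)) := by
    rw [(closedBall_eq_zpow_smul_iff p K _ k _).1 h]
    congr 1
    rw [zpow_sub₀ hϖ0, mul_comm k, zpow_mul, zpow_natCast, norm_pow_absRamificationIdx p K hϖ, inv_zpow',
      zpow_neg, div_inv_eq_mul, mul_comm]
  refine not_logUnits_subset_closedBall_of_prime_le p hϖ hp3 he ?_
  rw [hΛ]
  refine closedBall_subset_closedBall ?_
  calc ‖(ϖ : K)‖ ^ (j - k * absRamificationIdx p K) ≤ ‖(ϖ : K)‖ ^ (1 : ℤ) :=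
        zpow_le_zpow_right_of_le_one₀ hr0 hϖ.norm_lt_one.le hjk
    _ = ‖(ϖ : K)‖ := zpow_one _

/-- The same for the ball `{‖y‖ ≤ ‖t‖}` of any `t ≠ 0` (its radius is a power of `‖ϖ‖`).
[cite: NeukirchANT1999, Ch. II Prop. (5.5)–(5.7)] [cite: WeilBNT1967, Ch. II §2, Th. 1–2] -/
theorem closedBall_norm_ne_zpow_smul_logUnits_of_prime_le (hp3 : 3 ≤ p) (he : p ≤ absRamificationIdx p K)
    {t : K} (ht : t ≠ 0) (k : ℤ) : closedBall (0 : K) ‖t‖ ≠ ((p : ℚ_[p]) ^ k) • logUnits K := by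
  obtain ⟨j, hj⟩ := hϖ.2 (Units.mk0 t ht)
  rw [Units.val_mk0] at hj
  rw [hj]
  exact closedBall_ne_zpow_smul_logUnits_of_prime_le p hϖ hp3 he j k

end DeepRamification

end Literature.IUT.LogVolume

end
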